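import Summits.CriticalPhenomena.PercolationContinuityZ3.Theorems.PercNearOneGluingNoHeavyLowerTailSahiCTCG011Certs
import HarnessLib

/-!
# `NoHeavyLowerTail` (crux stmt-CriticalPhenomena-4575), P3 lane: **`G(0,1,1)(K_X,K_Z) ∈ ℕ[r]` for EVERY pair of simplicial complexes** — the first
# form of the c = 2 threshold-certificate table closed by kernel-checked step certificates (g9 §8.2: "PROVED (hypothesis-closed certified set): G011")

Support file (seat `prim-l12-p3`, gen 19; `--supports stmt-CriticalPhenomena-4575`).  Memo `run/shared/lean/prim/prim-l12/FROM-prim-l12-p3-g19-CERTIFICATE-ROAD-G011.md`;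
memo g9 (`…-g9-COEFFICIENTWISE-THRESHOLD-CERTIFICATE.md`) §7 for the inductive certificate framework.  Nothing is asserted about the crux.

`coeff_G011V_nonneg`: for every ground finset `V` of a finite type and all down-sets `K_X, K_Z ∋ ∅` of finsets, every coefficient of
`G011V V K_X K_Z = (Π+D₁)(Π·h_Y − h_X·h_Z) − Π·D₁·e_Y − D₁·(h_X·t_Z + t_X·h_Z) + Θ₁·t_X·t_Z` is `≥ 0`.  Proof: strong induction on `V`; delete any `v ∈ V`,
expand (`G011V_expand`), and use the certified step of the liveness case of `v` (`coeff_G011V_step_mm/lm/ll`, `ml` by `G011V_comm`); base `G011V_empty`.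
Every step is a finite polynomial identity checked by `ring` plus the Harris/LYM blocks (Kleitman, LYM) — no enumeration, all `k` at once.
-/

namespace Summit.CriticalPhenomena.PercolationContinuityZ3.Theorems.SahiCTCForms

open Finset MvPolynomial SahiCTCGenFun

variable {α : Type*} [DecidableEq α]

/-! ### The theorem: `G(0,1,1) ≥ 0` coefficientwise for every pair of complexes -/

section main
variable [Fintype α]

/-- **`G(0,1,1)(K_X,K_Z) ∈ ℕ[r]` for every ground finset `V` and every pair of simplicial complexes** (down-sets containing `∅`):
induction on `V`, deleting an arbitrary vertex and applying the certified step of the matching liveness case (g9 §8.2, kit j131614). [this work] -/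
theorem coeff_G011V_nonneg (V : Finset α) {KX KZ : Finset (Finset α)} (hKX : IsLowerSet (KX : Set (Finset α)))
    (hKZ : IsLowerSet (KZ : Set (Finset α))) (h0X : ∅ ∈ KX) (h0Z : ∅ ∈ KZ) : ∀ n, 0 ≤ (G011V V KX KZ).coeff n := by
  induction V using Finset.strongInduction generalizing KX KZ with
  | H V ih =>
    rcases V.eq_empty_or_nonempty with hV | ⟨v, hv⟩
    · subst hV; intro n; rw [G011V_empty KX KZ h0X h0Z, coeff_zero]
    · have hind := ih (V.erase v) (erase_ssubset hv) hKX hKZ h0X h0Z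
      by_cases hvX : {v} ∈ KX <;> by_cases hvZ : {v} ∈ KZ
      · exact coeff_G011V_step_ll V KX KZ v hv hKX hKZ hvX hvZ hind
      · exact coeff_G011V_step_lm V KX KZ v hv hKX hKZ h0Z hvX hvZ hind
      · have hind' : ∀ n, 0 ≤ (G011V (V.erase v) KZ KX).coeff n := ih (V.erase v) (erase_ssubset hv) hKZ hKX h0Z h0X
        intro n; rw [G011V_comm KX KZ V]
        exact coeff_G011V_step_lm V KZ KX v hv hKZ hKX h0X hvZ hvX hind' n
      · exact coeff_G011V_step_mm V KX KZ v hv hKX hKZ h0X h0Z hvX hvZ hind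

/-- The same on the whole finite type (`V = univ`): every coefficient of `G(0,1,1)(K_X, K_Z)` is nonnegative. [this work] -/
theorem coeff_G011_nonneg {KX KZ : Finset (Finset α)} (hKX : IsLowerSet (KX : Set (Finset α))) (hKZ : IsLowerSet (KZ : Set (Finset α)))
    (h0X : ∅ ∈ KX) (h0Z : ∅ ∈ KZ) : ∀ n, 0 ≤ (G011V (univ : Finset α) KX KZ).coeff n :=
  coeff_G011V_nonneg univ hKX hKZ h0X h0Z

end main

end Summit.CriticalPhenomena.PercolationContinuityZ3.Theorems.SahiCTCForms
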